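import Literature.Barriers.SmoothPoincare4.ExoticContractibleCorkTheoremProofs
import Literature.Barriers.SmoothPoincare4.OneStabilisationContractibleCorkProofs
import Literature.Topology.FourManifolds.GluingProofs
import Literature.Topology.FourManifolds.SPC4HandlesSymmHolds
import HarnessLib

/-!
# Barrier (SmoothPoincare4), corks: the cork fact across universes

Proof file next to `ExoticContractible.lean` (fact seat
`provefact-Literature.Barriers.SmoothPoincare4.akbulut1991_mazurCork`). The named fact
`Literature.Barriers.SmoothPoincare4.akbulut1991_mazurCork.{u}` ("a cork exists": a compact
contractible smooth 4-manifold `W : Type u`, a boundary datum `b` and a self-diffeomorphism `f`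
of `∂W` extending to a self-homeomorphism but to no self-diffeomorphism of `W`; Akbulut 1991,
Thms. 1-2) is universe polymorphic, and its discharge `akbulut1991_mazurCork_holds` has to hold
at EVERY universe, whereas every concrete cork — Akbulut's Mazur manifold as a subset of some
`ℝᴺ`, the cork of the Donaldson pair produced by the cork theorem
(`akbulut1991_mazurCork_of_corkTheorem`, universe `0`), Kang's cork
(`akbulut1991_mazurCork_of_theorem11`, universe `0`) — lives in `Type`. This file closes that
gap once and for all, with the tree's `ULift` infrastructure (`ManifoldULift.lean`: the manifold
`ULift W` with the charts of `W`; `BoundaryData.ulift`: boundary datum `ULift ∂W ↪ ULift W`;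
`BoundaryData.uliftDiffeo`: the boundary map `up ∘ f ∘ down`):

* `extendsToHomeomorph_ulift_iff`, `extendsToDiffeomorph_ulift_iff`: `up ∘ f ∘ down` extends
  over `ULift W` (topologically / smoothly) iff `f` extends over `W`;
* `isCork_ulift`: a cork lifts to a cork;
* `akbulut1991_mazurCork_universe_lift` (`.{v} → .{max v u}`) and
  `akbulut1991_mazurCork_of_universe_zero` (`.{0} → .{u}`): **the cork fact at universe `0`
  implies it at every universe**; likewise `akbulut1991_notExtendsToDiffeomorph_universe_lift` /
  `_of_universe_zero` for the smooth leaf of `ExoticContractibleProofs.lean`;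
* consequences: the polymorphic fact (hence `RelativeContractibleBarrierFour.{u}`) from any cork
  in `Type` (`akbulut1991_mazurCork_of_isCork_zero`), from the THREE remaining classical tree
  facts of the cork-theorem route — Matveyev's decomposition, the Donaldson exotic h-cobordant
  pair, Freedman–Quinn — now that gluing uniqueness (Hirsch 8.2.1,
  `nonempty_diffeomorph_of_isBoundaryGluing_holds`) is proved in the tree
  (`akbulut1991_mazurCork_of_matveyev_donaldson_freedmanQuinn`), and from Kang's Thm. 1.1 with
  Freedman–Quinn (`akbulut1991_mazurCork_of_theorem11_univ`).

Everything here is proved; no named fact is introduced. The mathematical content is the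
diffeomorphism invariance of all notions involved (Lee 2013, Ch. 1: structures transported
along `ULift W ≅ W`).

## References

[Akbulut1991Fake] [AkbulutYasui2008] [FreedmanQuinn1990] [Kang2022OneStabilization]
[LeeSmoothManifolds2013]
-/

noncomputable section

open scoped Manifold ContDiff
open Function Literature.Topology.FourManifolds

namespace Literature.Barriers.SmoothPoincare4

universe u v

/-! ### Transport of the extension predicates along `ULift` -/

section Transport

variable {C : Type v} [TopologicalSpace C] [ChartedSpace (EuclideanHalfSpace 4) C]
  [IsManifold (𝓡∂ 4) ∞ C]

/-- **Topological extension is invariant under the universe lift**: the lifted boundary map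
`up ∘ τ ∘ down` of `ULift ∂C` extends to a self-homeomorphism of `ULift C` iff `τ` extends to a
self-homeomorphism of `C` (conjugate the extension by the homeomorphism `ULift C ≃ₜ C`).
[folklore] -/
theorem extendsToHomeomorph_ulift_iff (b : BoundaryData (𝓡∂ 4) C (𝓡 3))
    (τ : b.carrier ≃ₘ⟮𝓡 3, 𝓡 3⟯ b.carrier) :
    ExtendsToHomeomorph (b.ulift : BoundaryData (𝓡∂ 4) (ULift.{u} C) (𝓡 3))
        (b.uliftDiffeo τ) ↔ ExtendsToHomeomorph b τ := by
  constructor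
  · rintro ⟨h, hh⟩
    refine ⟨(Homeomorph.ulift.symm.trans h).trans Homeomorph.ulift, fun x => ?_⟩
    exact congrArg ULift.down (hh (ULift.up x))
  · rintro ⟨h, hh⟩
    refine ⟨(Homeomorph.ulift.trans h).trans Homeomorph.ulift.symm, fun x => ?_⟩
    exact congrArg ULift.up (hh x.down)

/-- **Smooth extension is invariant under the universe lift**: `up ∘ τ ∘ down` extends to a
self-diffeomorphism of `ULift C` iff `τ` extends to a self-diffeomorphism of `C` (conjugate by
the canonical diffeomorphism `ULift C ≅ C`, `ManifoldULift.diffeomorph`). [folklore] -/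
theorem extendsToDiffeomorph_ulift_iff (b : BoundaryData (𝓡∂ 4) C (𝓡 3))
    (τ : b.carrier ≃ₘ⟮𝓡 3, 𝓡 3⟯ b.carrier) :
    ExtendsToDiffeomorph (b.ulift : BoundaryData (𝓡∂ 4) (ULift.{u} C) (𝓡 3))
        (b.uliftDiffeo τ) ↔ ExtendsToDiffeomorph b τ := by
  constructor
  · rintro ⟨g, hg⟩
    refine ⟨((ManifoldULift.diffeomorph (𝓡∂ 4) C ∞).symm.trans g).trans
      (ManifoldULift.diffeomorph (𝓡∂ 4) C ∞), fun x => ?_⟩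
    exact congrArg ULift.down (hg (ULift.up x))
  · rintro ⟨g, hg⟩
    refine ⟨((ManifoldULift.diffeomorph (𝓡∂ 4) C ∞).trans g).trans
      (ManifoldULift.diffeomorph (𝓡∂ 4) C ∞).symm, fun x => ?_⟩
    exact congrArg ULift.up (hg x.down)

omit [IsManifold (𝓡∂ 4) ∞ C] in
/-- The lifted boundary map of an involution is an involution. [folklore] -/
theorem involutive_uliftDiffeo (b : BoundaryData (𝓡∂ 4) C (𝓡 3))
    {τ : b.carrier ≃ₘ⟮𝓡 3, 𝓡 3⟯ b.carrier} (hτ : Involutive τ) :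
    Involutive (b.uliftDiffeo.{v, u} τ) := fun x =>
  (congrArg ULift.up (hτ x.down)).trans (ULift.up_down x)

/-- **A cork lifts to a cork**: if `(C, τ)` is a cork (tree's sense,
`Literature.Topology.FourManifolds.IsCork`) then so is `(ULift C, up ∘ τ ∘ down)`.
[cite: AkbulutYasui2008, Def. 2.1 (arXiv:0806.3010 §2 numbering)] -/
theorem isCork_ulift {b : BoundaryData (𝓡∂ 4) C (𝓡 3)} {τ : b.carrier ≃ₘ⟮𝓡 3, 𝓡 3⟯ b.carrier}
    (h : IsCork b τ) :
    IsCork (b.ulift : BoundaryData (𝓡∂ 4) (ULift.{u} C) (𝓡 3)) (b.uliftDiffeo τ) := by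
  haveI : CompactSpace C := h.isLooseCork.compactSpace
  haveI : T2Space C := h.isLooseCork.2.1
  haveI : ContractibleSpace C := h.isLooseCork.contractibleSpace
  haveI : ContractibleSpace (ULift.{u} C) := Homeomorph.ulift.contractibleSpace
  exact ⟨⟨inferInstance, inferInstance, inferInstance, involutive_uliftDiffeo b h.isLooseCork.involutive,
    (extendsToHomeomorph_ulift_iff b τ).2 h.isLooseCork.2.2.2.2⟩,
    fun h' => h.not_extendsToDiffeomorph ((extendsToDiffeomorph_ulift_iff b τ).1 h')⟩

end Transport

/-! ### The cork fact and its smooth leaf across universes -/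

/-- **The cork fact lifts along universes**: a cork `(W, b, f)` with `W : Type v` gives the
cork `(ULift W, b.ulift, up ∘ f ∘ down)` with `ULift W : Type (max v u)` — compactness,
Hausdorffness, second countability, contractibility and the smooth structure pass to `ULift W`
(Mathlib; `ManifoldULift.lean`), and the two extension clauses are invariant
(`extendsToHomeomorph_ulift_iff`, `extendsToDiffeomorph_ulift_iff`).
[cite: Akbulut1991Fake, Thms. 1-2] -/
theorem akbulut1991_mazurCork_universe_lift (h : akbulut1991_mazurCork.{v}) :
    akbulut1991_mazurCork.{max v u} := by
  obtain ⟨W, _, _, _, _, _, _, _, b, f, hH, hD⟩ := h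
  haveI : ContractibleSpace (ULift.{u} W) := Homeomorph.ulift.contractibleSpace
  exact ⟨ULift.{u} W, inferInstance, inferInstance, inferInstance, inferInstance, inferInstance,
    inferInstance, inferInstance, b.ulift, b.uliftDiffeo f, (extendsToHomeomorph_ulift_iff b f).2 hH,
    fun h' => hD ((extendsToDiffeomorph_ulift_iff b f).1 h')⟩

/-- **The cork fact at universe `0` implies it at every universe.** Any concrete cork (a
subset of some `ℝᴺ`, a handlebody, …) lives in `Type`; this is the bridge to the polymorphic
named fact. [cite: Akbulut1991Fake, Thms. 1-2] -/
theorem akbulut1991_mazurCork_of_universe_zero (h : akbulut1991_mazurCork.{0}) :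
    akbulut1991_mazurCork.{u} :=
  akbulut1991_mazurCork_universe_lift.{u, 0} h

/-- **The smooth leaf lifts along universes**: `akbulut1991_notExtendsToDiffeomorph.{v}`
(a compact contractible smooth 4-manifold with an involution of its boundary extending to no
self-diffeomorphism) implies the same at universe `max v u` (lift to `ULift W`; involutivity by
`involutive_uliftDiffeo`, non-extension by `extendsToDiffeomorph_ulift_iff`).
[cite: Akbulut1991Fake, Thm. 2] -/
theorem akbulut1991_notExtendsToDiffeomorph_universe_lift
    (h : akbulut1991_notExtendsToDiffeomorph.{v}) :
    akbulut1991_notExtendsToDiffeomorph.{max v u} := by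
  obtain ⟨W, _, _, _, _, _, _, _, b, τ, hτ, hD⟩ := h
  haveI : ContractibleSpace (ULift.{u} W) := Homeomorph.ulift.contractibleSpace
  exact ⟨ULift.{u} W, inferInstance, inferInstance, inferInstance, inferInstance, inferInstance,
    inferInstance, inferInstance, b.ulift, b.uliftDiffeo τ, involutive_uliftDiffeo b hτ,
    fun h' => hD ((extendsToDiffeomorph_ulift_iff b τ).1 h')⟩

/-- The smooth leaf at universe `0` implies it at every universe.
[cite: Akbulut1991Fake, Thm. 2] -/
theorem akbulut1991_notExtendsToDiffeomorph_of_universe_zero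
    (h : akbulut1991_notExtendsToDiffeomorph.{0}) :
    akbulut1991_notExtendsToDiffeomorph.{u} :=
  akbulut1991_notExtendsToDiffeomorph_universe_lift.{u, 0} h

/-! ### Consequences: the polymorphic fact from universe-`0` inputs -/

/-- **Any cork in `Type` proves the (polymorphic) cork fact**: a cork in the tree's sense on a
second countable `W : Type` witnesses `akbulut1991_mazurCork.{u}` for every `u`
(`akbulut1991_mazurCork_of_isCork` and the universe lift).
[cite: AkbulutRuberman2016, §1] [cite: Akbulut1991Fake, Thms. 1-2] -/
theorem akbulut1991_mazurCork_of_isCork_zero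
    (h : ∃ (W : Type) (_ : TopologicalSpace W) (_ : SecondCountableTopology W)
      (_ : ChartedSpace (EuclideanHalfSpace 4) W) (_ : IsManifold (𝓡∂ 4) ∞ W)
      (b : BoundaryData (𝓡∂ 4) W (𝓡 3)) (τ : b.carrier ≃ₘ⟮𝓡 3, 𝓡 3⟯ b.carrier), IsCork b τ) :
    akbulut1991_mazurCork.{u} :=
  akbulut1991_mazurCork_of_universe_zero (akbulut1991_mazurCork_of_isCork h)

/-- **The cork fact, at every universe, from the smooth leaf and Freedman–Quinn at universe
`0`** (`akbulut1991_mazurCork_of_notExtendsToDiffeomorph` and the universe lift): the two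
printed halves of Akbulut's theorem need only be supplied for manifolds in `Type`.
[cite: Akbulut1991Fake, Thm. 2 and p. 335] [cite: FreedmanQuinn1990, Prop. 11.1C (trivial group)] -/
theorem akbulut1991_mazurCork_of_notExtendsToDiffeomorph_zero
    (hA : akbulut1991_notExtendsToDiffeomorph.{0})
    (hF : freedmanQuinn1990_homeomorph_extends_contractible.{0}) :
    akbulut1991_mazurCork.{u} :=
  akbulut1991_mazurCork_of_universe_zero (akbulut1991_mazurCork_of_notExtendsToDiffeomorph hA hF)

/-- **The cork fact (every universe) from three classical tree facts**: Matveyev's cork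
decomposition (`hM`), the Donaldson–Freedman–Wall exotic h-cobordant pair (`hD`) and
Freedman–Quinn 11.1C (`hF`), all at universe `0`. The fourth input of
`akbulut1991_mazurCork_of_corkTheorem` — uniqueness of the gluing `M ∪_φ N` (Hirsch, Thm. 8.2.1)
— is now a theorem of the tree (`nonempty_diffeomorph_of_isBoundaryGluing_holds`,
`GluingProofs.lean`) and is supplied here; the conclusion is made polymorphic by
`akbulut1991_mazurCork_of_universe_zero`. The witness is a cork of the Donaldson pair, not
necessarily Akbulut's Mazur cork (the fact is an existence statement).
[cite: AkbulutYasui2008, §1 (the cork theorem [M], [C])] [cite: FreedmanQuinn1990, Prop. 11.1C (trivial group)] [cite: HirschDT1976, Ch. 8 §2, Thm. 2.1] -/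
theorem akbulut1991_mazurCork_of_matveyev_donaldson_freedmanQuinn
    (hM : Matveyev1996_decomposition.{0})
    (hD : exists_isHCobordant_isEmpty_diffeomorph_four)
    (hF : freedmanQuinn1990_homeomorph_extends_contractible.{0}) :
    akbulut1991_mazurCork.{u} :=
  akbulut1991_mazurCork_of_universe_zero
    (akbulut1991_mazurCork_of_corkTheorem
      (fun {_ _} _ _ _ _ _ _ _ _ _ _ _ _ {_ _ _ _} _ _ _ _ _ _ =>
        nonempty_diffeomorph_of_isBoundaryGluing_holds)
      hM hD hF)

/-- **`RelativeContractibleBarrierFour` at every universe from the same three classical facts**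
(compare `relativeContractibleBarrierFour_of_corkTheorem`: four facts, universe `0`).
[cite: AkbulutYasui2008, §1 (the cork theorem [M], [C])] [cite: AkbulutRuberman2016, §1] -/
theorem relativeContractibleBarrierFour_of_matveyev_donaldson_freedmanQuinn
    (hM : Matveyev1996_decomposition.{0})
    (hD : exists_isHCobordant_isEmpty_diffeomorph_four)
    (hF : freedmanQuinn1990_homeomorph_extends_contractible.{0}) :
    RelativeContractibleBarrierFour.{u} :=
  relativeContractibleBarrierFour_of_akbulut
    (akbulut1991_mazurCork_of_matveyev_donaldson_freedmanQuinn hM hD hF)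

/-- **The cork fact (every universe) from Kang's Thm. 1.1 and Freedman–Quinn** (both at
universe `0`; `akbulut1991_mazurCork_of_theorem11` and the universe lift).
[cite: Kang2022OneStabilization, Thm. 1.1 and §1 (definition of a cork)] [cite: FreedmanQuinn1990, Prop. 11.1C (trivial group)] -/
theorem akbulut1991_mazurCork_of_theorem11_univ (h11 : kang2022_theorem11)
    (hF : freedmanQuinn1990_homeomorph_extends_contractible.{0}) :
    akbulut1991_mazurCork.{u} :=
  akbulut1991_mazurCork_of_universe_zero (akbulut1991_mazurCork_of_theorem11 h11 hF)

/-- `RelativeContractibleBarrierFour` at every universe from Kang's Thm. 1.1 and Freedman–Quinn.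
[cite: Kang2022OneStabilization, Thm. 1.1] [cite: AkbulutRuberman2016, §1] -/
theorem relativeContractibleBarrierFour_of_theorem11_univ (h11 : kang2022_theorem11)
    (hF : freedmanQuinn1990_homeomorph_extends_contractible.{0}) :
    RelativeContractibleBarrierFour.{u} :=
  relativeContractibleBarrierFour_of_akbulut (akbulut1991_mazurCork_of_theorem11_univ h11 hF)

end Literature.Barriers.SmoothPoincare4

end
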